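import Literature.Computability.Complexity.CodeFPStrings
import Literature.Computability.Complexity.CodeFPArith
import Literature.Computability.Complexity.CodeFPListKit
import Literature.Computability.Complexity.NondeterministicProofs
import Literature.Computability.Complexity.StringEquality
import Mathlib
import HarnessLib

/-!
# Amplified critical window — stub S, part 1: the certificate verifier of the `RM3 ⊗ CLIQUE` language
(cell pnp-ideate, rung F-N1/p3, ROUND-11; line `amplified-window` on item stmt-PneNP-19860, stub S
`AmplifiedCliqueSlicesNP`; card HOME/pnp-ideate-p3/r11/amplified-window.md §4)

The `NP` witness of the line is ONE language `ampCliqueLang` whose slice at length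
`ampLen n k = 3^d·n² + k` (`d = ⌊log₃ n⌋`, `3 ≤ k < n`) is the recursive majority of depth `d` of the
`3^d` clique indicators `CLIQUE(n,k)` of the `3^d` consecutive `n × n` upper-triangle bit matrices of
the input (part 2, `NegLimitedAmplifiedWindowSlicesNP.lean`).  This file is the polynomial-time
VERIFIER, written as a mathematical function `verdict : {0,1}* × {0,1}* → Bool` on (input,
certificate) and proved polynomial-time computable on codes with the tree's typed `CodeFP` algebra:

* the certificate `y = ⟨1ⁿ, ⟨1ᵏ, ⟨1ᵈ, T⟩⟩⟩` names the parameters (read back with the total pair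
  projections `fstF`/`sndF`, so EVERY string parses) and a mark string `T` (`T[w·n + v]`: vertex `v`
  is marked in block `w`);
* `checks`: `3 ≤ k < n`, `3^d ≤ n < 3^{d+1}` (i.e. `d = ⌊log₃ n⌋`) and `|u| = 3^d n² + k`;
* `blockBit u T n k w`: block `w` marks exactly `k` vertices (`markCount`) and every marked pair
  `a < b` is an edge of block `w` (`u[w n² + (b + n a)] = 1`, `pairOK`);
* `round`/`rounds`: `d` rounds of stride-`L/3` three-majorities evaluate the recursive majority on the
  level-`0` string `lev0 = [blockBit 0, …, blockBit (3^d − 1)]`;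
* `verdict = checks ∧ (rounds d lev0)[0]`; `codeFP_verdict`; the language `ampCliqueLang` (certificate
  length budget `4·|u| + 8`) and `ampCliqueLang_mem_NP`.

References: S. Arora, B. Barak, *Computational Complexity* (2009), §1.3 (closure of polynomial time
under composition and bounded loops), §2.1 Def. 2.1 / Ex. 2.2 (certificate definition of `NP`,
`CLIQUE ∈ NP`) [AroraBarakCC2009]; R. O'Donnell, *Hardness amplification within NP*, JCSS 69 (2004), §1
(recursive-majority amplification stays inside `NP`).

HONEST FRAMING: verifier plumbing for stub S of an OPEN line; nothing here bears on P vs NP.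
-/

set_option linter.dupNamespace false -- `Summit.PneNP.PneNP.…`: summit = sub-problem name (D-0017 single-conjunct layout)

namespace Summit.PneNP.PneNP.Theorems.NegLimitedAmplifiedWindow.SlicesNP

open Literature.Computability.Complexity Literature.Computability.Complexity.Brick
  Literature.Computability.Complexity.CodeFP _root_.Computability Polynomial

/-! ### The verifier as a mathematical function -/

/-- Three-bit majority (the line's `maj3`, restated on `Bool` arguments to keep this file free of the
line's `Defs` import; identified by `rfl` downstream). -/
def maj (a b c : Bool) : Bool := (a && b) || (a && c) || (b && c)

/-- One evaluation round: the stride-`L/3` three-majorities of a level string of length `L`. -/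
def round (s : List Bool) : List Bool :=
  (List.range (min (s.length / 3) s.length)).map fun t =>
    maj (s.getD t false) (s.getD (t + s.length / 3) false) (s.getD (t + 2 * (s.length / 3)) false)

/-- `d` evaluation rounds. -/
def rounds (d : ℕ) (s : List Bool) : List Bool := (List.replicate d ()).foldl (fun s _ => round s) s

/-- The number of marked vertices of block `w` (`T[w n + v]`, `v < n`). -/
def markCount (T : List Bool) (n w : ℕ) : ℕ :=
  ((List.range n).map fun v => if T.getD (w * n + v) false then 1 else 0).sum

/-- The pair test of block `w`: if `a < b` are both marked then `{a, b}` is an edge of block `w` of `u`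
(upper-triangle position `b + n a` of the `w`-th `n × n` matrix). -/
def pairOK (u T : List Bool) (n w : ℕ) (ab : ℕ × ℕ) : Bool :=
  !decide (ab.1 < ab.2) || (!T.getD (w * n + ab.1) false || (!T.getD (w * n + ab.2) false ||
    u.getD (w * (n * n) + (ab.2 + n * ab.1)) false))

/-- The block bit: block `w` marks exactly `k` vertices, pairwise adjacent in block `w` of `u`. -/
def blockBit (u T : List Bool) (n k w : ℕ) : Bool :=
  decide (markCount T n w = k) && ((List.range n).product (List.range n)).all (pairOK u T n w)

/-- The level-`0` string of block bits (length `min (3^d) n`, `= 3^d` under `checks`). -/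
def lev0 (u T : List Bool) (n k d : ℕ) : List Bool :=
  (List.range (min (3 ^ d) n)).map (blockBit u T n k)

/-- `n` read off the certificate `⟨1ⁿ, ⟨1ᵏ, ⟨1ᵈ, T⟩⟩⟩`. -/
def cn (y : List Bool) : ℕ := (fstF y).length

/-- `k` read off the certificate. -/
def ck (y : List Bool) : ℕ := (fstF (sndF y)).length

/-- `d` read off the certificate. -/
def cd (y : List Bool) : ℕ := (fstF (sndF (sndF y))).length

/-- The mark string `T` read off the certificate. -/
def cT (y : List Bool) : List Bool := sndF (sndF (sndF y))

/-- The parameter checks: `3 ≤ k < n`, `3^d ≤ n < 3^{d+1}`, `|u| = 3^d n² + k`. -/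
def checks (u y : List Bool) : Bool :=
  decide (3 ≤ ck y) && (decide (ck y < cn y) && (decide (3 ^ cd y ≤ cn y) &&
    (decide (cn y < 3 ^ (cd y + 1)) && decide (u.length = 3 ^ cd y * (cn y * cn y) + ck y))))

/-- **The verdict** on (input, certificate). -/
def verdict (p : List Bool × List Bool) : Bool :=
  checks p.1 p.2 && (rounds (cd p.2) (lev0 p.1 (cT p.2) (cn p.2) (ck p.2) (cd p.2))).getD 0 false

/-! ### Elementary facts -/

/-- A round does not lengthen the level string. -/
theorem length_round_le (s : List Bool) : (round s).length ≤ s.length := by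
  simp only [round, List.length_map, List.length_range]
  exact min_le_right _ _

/-- Rounds do not lengthen the level string. -/
theorem length_foldl_round_le (l : List Unit) (s : List Bool) :
    (l.foldl (fun s _ => round s) s).length ≤ s.length := by
  induction l generalizing s with
  | nil => simp
  | cons _ l ih => exact (ih _).trans (length_round_le s)

/-- The level-`0` string has at most `n` bits. -/
theorem length_lev0_le (u T : List Bool) (n k d : ℕ) : (lev0 u T n k d).length ≤ n := by
  simp only [lev0, List.length_map, List.length_range]
  exact min_le_right _ _

/-- `n ≤ |y|`. -/
theorem cn_le_length (y : List Bool) : cn y ≤ y.length := by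
  have := length_fstF_sndF_le y
  unfold cn; omega

/-- The parameter checks, unfolded. -/
theorem checks_eq_true_iff {u y : List Bool} :
    checks u y = true ↔ 3 ≤ ck y ∧ ck y < cn y ∧ 3 ^ cd y ≤ cn y ∧ cn y < 3 ^ (cd y + 1) ∧
      u.length = 3 ^ cd y * (cn y * cn y) + ck y := by
  simp only [checks, Bool.and_eq_true, decide_eq_true_iff]

/-- The verdict, unfolded. -/
theorem verdict_eq_true_iff {u y : List Bool} :
    verdict (u, y) = true ↔ checks u y = true ∧
      (rounds (cd y) (lev0 u (cT y) (cn y) (ck y) (cd y))).getD 0 false = true := by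
  simp only [verdict, Bool.and_eq_true]

/-- The pair test, unfolded. -/
theorem pairOK_eq_true_iff {u T : List Bool} {n w : ℕ} {ab : ℕ × ℕ} :
    pairOK u T n w ab = true ↔ (ab.1 < ab.2 → T.getD (w * n + ab.1) false = true →
      T.getD (w * n + ab.2) false = true → u.getD (w * (n * n) + (ab.2 + n * ab.1)) false = true) := by
  unfold pairOK
  cases T.getD (w * n + ab.1) false <;> cases T.getD (w * n + ab.2) false <;>
    cases u.getD (w * (n * n) + (ab.2 + n * ab.1)) false <;> by_cases h : ab.1 < ab.2 <;> simp [h]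

/-- The block bit, unfolded. -/
theorem blockBit_eq_true_iff {u T : List Bool} {n k w : ℕ} :
    blockBit u T n k w = true ↔ markCount T n w = k ∧ ∀ a b, a < n → b < n → a < b →
      T.getD (w * n + a) false = true → T.getD (w * n + b) false = true →
        u.getD (w * (n * n) + (b + n * a)) false = true := by
  simp only [blockBit, Bool.and_eq_true, decide_eq_true_iff, List.all_eq_true, pairOK_eq_true_iff,
    List.pair_mem_product, List.mem_range, Prod.forall, and_imp]

/-- The mark count is the number of marked vertices. -/
theorem markCount_eq_card (T : List Bool) (n w : ℕ) :
    markCount T n w = ((Finset.range n).filter fun v => T.getD (w * n + v) false = true).card := by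
  -- list sums over `range` are `Finset` sums (as in `PermMod2.sum_map_range`, not imported here)
  have hsum : ∀ (f : ℕ → ℕ) (m : ℕ), ((List.range m).map f).sum = ∑ i ∈ Finset.range m, f i := by
    intro f m
    induction m with
    | zero => simp
    | succ m ih => rw [List.range_succ, List.map_append, List.sum_append, ih, Finset.sum_range_succ]; simp
  unfold markCount
  rw [Finset.card_filter, hsum]

/-- The honest certificate `⟨1ⁿ, ⟨1ᵏ, ⟨1ᵈ, T⟩⟩⟩`. -/
def cert (n k d : ℕ) (T : List Bool) : List Bool :=
  boolPair (List.replicate n true) (boolPair (List.replicate k true) (boolPair (List.replicate d true) T))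

/-- Its `n`. -/
@[simp] theorem cn_cert (n k d : ℕ) (T : List Bool) : cn (cert n k d T) = n := by simp [cn, cert]

/-- Its `k`. -/
@[simp] theorem ck_cert (n k d : ℕ) (T : List Bool) : ck (cert n k d T) = k := by simp [ck, cert]

/-- Its `d`. -/
@[simp] theorem cd_cert (n k d : ℕ) (T : List Bool) : cd (cert n k d T) = d := by simp [cd, cert]

/-- Its mark string. -/
@[simp] theorem cT_cert (n k d : ℕ) (T : List Bool) : cT (cert n k d T) = T := by simp [cT, cert]

/-- Its length: `2n + 2k + 2d + 6 + |T|`. -/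
theorem length_cert (n k d : ℕ) (T : List Bool) :
    (cert n k d T).length = 2 * n + 2 * k + 2 * d + 6 + T.length := by
  simp only [cert, length_boolPair, List.length_replicate]; ring

/-! ### Polynomial time on codes -/

/-- The code of (input, certificate): the pair of the two raw strings. -/
abbrev E : List Bool × List Bool → List Bool := pairE strE strE

/-- `n` in binary (the pair projections `fstF`, `sndF` are bricks; as `CodeFP strE strE` maps they are
`QuantumAdvantage.fstF_code` / `SumcheckIP.sndC`, inlined here rather than imported). -/
theorem codeFP_cn : CodeFP strE natE cn := strNatLength.comp ⟨fstF, fstF_mem_FP, fun _ => rfl⟩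

/-- `n` in unary. -/
theorem codeFP_cnU : CodeFP strE unE cn := strLength.comp ⟨fstF, fstF_mem_FP, fun _ => rfl⟩

/-- `k` in binary. -/
theorem codeFP_ck : CodeFP strE natE ck :=
  strNatLength.comp ⟨fstF ∘ sndF, comp_mem_FP fstF_mem_FP sndF_mem_FP, fun _ => rfl⟩

/-- `d` in unary. -/
theorem codeFP_cdU : CodeFP strE unE cd :=
  strLength.comp ⟨fstF ∘ (sndF ∘ sndF), comp_mem_FP fstF_mem_FP (comp_mem_FP sndF_mem_FP sndF_mem_FP),
    fun _ => rfl⟩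

/-- `T`. -/
theorem codeFP_cT : CodeFP strE strE cT :=
  ⟨sndF ∘ (sndF ∘ sndF), comp_mem_FP sndF_mem_FP (comp_mem_FP sndF_mem_FP sndF_mem_FP), fun _ => rfl⟩

/-- `3^d` in binary. -/
theorem codeFP_pow3 : CodeFP strE natE (fun y => 3 ^ cd y) := natPow.comp ((const strE 3).pair codeFP_cdU)

/-- `3^{d+1}` in binary. -/
theorem codeFP_pow3succ : CodeFP strE natE (fun y => 3 ^ (cd y + 1)) :=
  natPow.comp ((const strE 3).pair (unSucc.comp codeFP_cdU))

/-- The parameter checks are polynomial time. -/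
theorem codeFP_checks : CodeFP E bitE (fun p => checks p.1 p.2) := by
  have hy : CodeFP E strE Prod.snd := snd _ _
  have hn : CodeFP E natE (fun p => cn p.2) := codeFP_cn.comp hy
  have hk : CodeFP E natE (fun p => ck p.2) := codeFP_ck.comp hy
  have h1 : CodeFP E bitE (fun p => decide (3 ≤ ck p.2)) := natLe.comp ((const E 3).pair hk)
  have h2 : CodeFP E bitE (fun p => decide (ck p.2 < cn p.2)) := natLt.comp (hk.pair hn)
  have h3 : CodeFP E bitE (fun p => decide (3 ^ cd p.2 ≤ cn p.2)) :=
    natLe.comp ((codeFP_pow3.comp hy).pair hn)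
  have h4 : CodeFP E bitE (fun p => decide (cn p.2 < 3 ^ (cd p.2 + 1))) :=
    natLt.comp (hn.pair (codeFP_pow3succ.comp hy))
  have h5 : CodeFP E bitE (fun p => decide (p.1.length = 3 ^ cd p.2 * (cn p.2 * cn p.2) + ck p.2)) :=
    natEq.comp ((strNatLength.comp (fst _ _)).pair
      (natAdd.comp ((natMul.comp ((codeFP_pow3.comp hy).pair (natMul.comp (hn.pair hn)))).pair hk)))
  exact h1.and (h2.and (h3.and (h4.and h5)))

/-- One evaluation round is polynomial time. -/
theorem codeFP_round : CodeFP strE strE round := by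
  have hL3 : CodeFP strE natE (fun s => s.length / 3) := natDiv.comp (strNatLength.pair (const strE 3))
  have hrange : CodeFP strE (rawE natE) (fun s => List.range (min (s.length / 3) s.length)) :=
    urange.comp (unOfNatMin.comp (strLength.pair hL3))
  -- the item map, context `s`, item `t`
  have hs : CodeFP (pairE strE natE) strE Prod.fst := fst _ _
  have ht : CodeFP (pairE strE natE) natE Prod.snd := snd _ _
  have hl : CodeFP (pairE strE natE) natE (fun q => q.1.length / 3) := hL3.comp hs
  have hb0 : CodeFP (pairE strE natE) bitE (fun q => q.1.getD q.2 false) := strGetDNat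
  have hb1 : CodeFP (pairE strE natE) bitE (fun q => q.1.getD (q.2 + q.1.length / 3) false) :=
    strGetDNat.comp (hs.pair (natAdd.comp (ht.pair hl)))
  have hb2 : CodeFP (pairE strE natE) bitE (fun q => q.1.getD (q.2 + 2 * (q.1.length / 3)) false) :=
    strGetDNat.comp (hs.pair (natAdd.comp (ht.pair (natMul.comp ((const _ 2).pair hl)))))
  have hmaj : CodeFP (pairE strE natE) bitE (fun q => maj (q.1.getD q.2 false)
      (q.1.getD (q.2 + q.1.length / 3) false) (q.1.getD (q.2 + 2 * (q.1.length / 3)) false)) :=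
    ((hb0.and hb1).or (hb0.and hb2)).or (hb1.and hb2)
  exact (bitsToStr.comp ((map hmaj).comp ((CodeFP.id strE).pair hrange))).congr fun _ => rfl

/-- The block bit is polynomial time (context `(u, y)`, item `w`). -/
theorem codeFP_blockBit :
    CodeFP (pairE E natE) bitE (fun q => blockBit q.1.1 (cT q.1.2) (cn q.1.2) (ck q.1.2) q.2) := by
  -- accessors at context depth `(ε, w)`
  have hε : CodeFP (pairE E natE) E Prod.fst := fst _ _
  have hw : CodeFP (pairE E natE) natE Prod.snd := snd _ _
  have hy : CodeFP (pairE E natE) strE (fun q => q.1.2) := hε.snd'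
  have hn : CodeFP (pairE E natE) natE (fun q => cn q.1.2) := codeFP_cn.comp hy
  have hnU : CodeFP (pairE E natE) unE (fun q => cn q.1.2) := codeFP_cnU.comp hy
  have hT : CodeFP (pairE E natE) strE (fun q => cT q.1.2) := codeFP_cT.comp hy
  have hrange : CodeFP (pairE E natE) (rawE natE) (fun q => List.range (cn q.1.2)) := urange.comp hnU
  -- the count, item `v`
  have hind : CodeFP (pairE (pairE E natE) natE) natE
      (fun r => if (cT r.1.1.2).getD (r.1.2 * cn r.1.1.2 + r.2) false then 1 else 0) :=
    (strGetDNat.comp ((hT.comp (fst _ _)).pair (natAdd.comp ((natMul.comp ((hw.comp (fst _ _)).pair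
      (hn.comp (fst _ _)))).pair (snd _ _))))).ite (const _ 1) (const _ 0)
  have hcount : CodeFP (pairE E natE) natE (fun q => markCount (cT q.1.2) (cn q.1.2) q.2) :=
    (natSum.comp ((map hind).comp ((CodeFP.id _).pair hrange))).congr fun _ => rfl
  -- the pair test, item `ab`
  have hu' : CodeFP (pairE (pairE E natE) (pairE natE natE)) strE (fun r => r.1.1.1) := (fst _ _).fst'.fst'
  have hT' : CodeFP (pairE (pairE E natE) (pairE natE natE)) strE (fun r => cT r.1.1.2) := hT.comp (fst _ _)
  have hn' : CodeFP (pairE (pairE E natE) (pairE natE natE)) natE (fun r => cn r.1.1.2) := hn.comp (fst _ _)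
  have hw' : CodeFP (pairE (pairE E natE) (pairE natE natE)) natE (fun r => r.1.2) := (fst _ _).snd'
  have ha : CodeFP (pairE (pairE E natE) (pairE natE natE)) natE (fun r => r.2.1) := (snd _ _).fst'
  have hb : CodeFP (pairE (pairE E natE) (pairE natE natE)) natE (fun r => r.2.2) := (snd _ _).snd'
  have hwn : CodeFP (pairE (pairE E natE) (pairE natE natE)) natE (fun r => r.1.2 * cn r.1.1.2) :=
    natMul.comp (hw'.pair hn')
  have hTa : CodeFP (pairE (pairE E natE) (pairE natE natE)) bitE
      (fun r => (cT r.1.1.2).getD (r.1.2 * cn r.1.1.2 + r.2.1) false) :=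
    strGetDNat.comp (hT'.pair (natAdd.comp (hwn.pair ha)))
  have hTb : CodeFP (pairE (pairE E natE) (pairE natE natE)) bitE
      (fun r => (cT r.1.1.2).getD (r.1.2 * cn r.1.1.2 + r.2.2) false) :=
    strGetDNat.comp (hT'.pair (natAdd.comp (hwn.pair hb)))
  have hub : CodeFP (pairE (pairE E natE) (pairE natE natE)) bitE
      (fun r => r.1.1.1.getD (r.1.2 * (cn r.1.1.2 * cn r.1.1.2) + (r.2.2 + cn r.1.1.2 * r.2.1)) false) :=
    strGetDNat.comp (hu'.pair (natAdd.comp ((natMul.comp (hw'.pair (natMul.comp (hn'.pair hn')))).pair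
      (natAdd.comp (hb.pair (natMul.comp (hn'.pair ha)))))))
  have hpair : CodeFP (pairE (pairE E natE) (pairE natE natE)) bitE
      (fun r => pairOK r.1.1.1 (cT r.1.1.2) (cn r.1.1.2) r.1.2 r.2) :=
    ((natLt.comp (ha.pair hb)).not.or (hTa.not.or (hTb.not.or hub))).congr fun _ => rfl
  have hpairs : CodeFP (pairE E natE) (rawE (pairE natE natE))
      (fun q => (List.range (cn q.1.2)).product (List.range (cn q.1.2))) :=
    (rawProduct natE natE).comp (hrange.pair hrange)
  have hall : CodeFP (pairE E natE) bitE
      (fun q => ((List.range (cn q.1.2)).product (List.range (cn q.1.2))).all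
        (pairOK q.1.1 (cT q.1.2) (cn q.1.2) q.2)) :=
    ((all hpair).comp ((CodeFP.id _).pair hpairs)).congr fun _ => rfl
  exact ((natEq.comp (hcount.pair (codeFP_ck.comp hy))).and hall).congr fun _ => rfl

/-- The level-`0` string is polynomial time. -/
theorem codeFP_lev0 : CodeFP E strE (fun p => lev0 p.1 (cT p.2) (cn p.2) (ck p.2) (cd p.2)) := by
  have hy : CodeFP E strE Prod.snd := snd _ _
  have hrange : CodeFP E (rawE natE) (fun p => List.range (min (3 ^ cd p.2) (cn p.2))) :=
    urange.comp (unOfNatMin.comp ((codeFP_cnU.comp hy).pair (codeFP_pow3.comp hy)))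
  exact (bitsToStr.comp ((map codeFP_blockBit).comp ((CodeFP.id E).pair hrange))).congr fun _ => rfl

/-- The evaluation rounds on the level-`0` string are polynomial time (the accumulator only shrinks). -/
theorem codeFP_rounds :
    CodeFP E strE (fun p => rounds (cd p.2) (lev0 p.1 (cT p.2) (cn p.2) (ck p.2) (cd p.2))) := by
  have hstep : CodeFP (pairE E (pairE unitE strE)) strE (fun t => round t.2.2) :=
    codeFP_round.comp (snd _ _).snd'
  have h := foldl (σ := List Bool × List Bool) (α := Unit) (eσ := E) (eα := unitE) (eβ := strE)
    (step := fun _ _ s => round s) (init := fun p => lev0 p.1 (cT p.2) (cn p.2) (ck p.2) (cd p.2))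
    hstep codeFP_lev0 X (fun p l₁ l₂ => by
      rw [eval_X]
      refine (length_foldl_round_le l₁ _).trans ((length_lev0_le _ _ _ _ _).trans
        ((cn_le_length p.2).trans ?_))
      simp only [pairE_apply, length_boolPair]
      have h2 : (strE p.2).length = p.2.length := rfl
      omega)
  exact (h.comp ((CodeFP.id E).pair (replicateUnit.comp (codeFP_cdU.comp (snd _ _))))).congr
    fun _ => rfl

/-- **The verdict is polynomial time on codes.** -/
theorem codeFP_verdict : CodeFP E bitE verdict :=
  (codeFP_checks.and (strGetDNat.comp (codeFP_rounds.pair (const E 0)))).congr fun _ => rfl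

/-! ### The language and its membership in `NP` -/

/-- **The `RM3 ⊗ CLIQUE` language**: inputs with an accepted certificate of length `≤ 4|u| + 8`. -/
def ampCliqueLang : Language Bool :=
  {u | ∃ y : List Bool, y.length ≤ (4 * X + 8 : Polynomial ℕ).eval u.length ∧ verdict (u, y) = true}

/-- Membership, unfolded. -/
theorem mem_ampCliqueLang {u : List Bool} :
    u ∈ ampCliqueLang ↔ ∃ y : List Bool, y.length ≤ 4 * u.length + 8 ∧ verdict (u, y) = true := by
  change (∃ y : List Bool, y.length ≤ (4 * X + 8 : Polynomial ℕ).eval u.length ∧ verdict (u, y) = true) ↔ _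
  simp

/-- **`ampCliqueLang ∈ NP`** (certificate definition, verifier `verdict ∈ FP`). -/
theorem ampCliqueLang_mem_NP : ampCliqueLang ∈ Nondeterministic.NP := by
  obtain ⟨f, hf, hfv⟩ := codeFP_verdict
  refine mem_NP_iff_verifier.2 ⟨{z | f z = [true]}, setOf_apply_eq_apply_mem_P hf (const_mem_FP [true]),
    4 * X + 8, fun u => ?_⟩
  refine exists_congr fun y => and_congr Iff.rfl ?_
  change verdict (u, y) = true ↔ f (boolPair u y) = [true]
  rw [show boolPair u y = E (u, y) from rfl, hfv]
  simp [bitE]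

end Summit.PneNP.PneNP.Theorems.NegLimitedAmplifiedWindow.SlicesNP
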